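import Summits.KontsevichZagierPeriods.KontsevichZagierPeriods.Theorems.LinRedNormalFormArrangementNormalFormSeparateThreeKUnblocked
import Summits.KontsevichZagierPeriods.KontsevichZagierPeriods.Theorems.LinRedNormalFormArrangementNormalFormSeparateSplit
import Summits.KontsevichZagierPeriods.KontsevichZagierPeriods.Theorems.LinRedNormalFormArrangementNormalFormSeparateTaylor

/-!
# The piece theorem of the separation engine with fibres, every base dimension
(stub `stub_separateHigh`, part `KPiece`)

(Line `janus-bands`, crux `ArrangementNormalForm`, stub `stub_separateHigh` — separation in base
dimension `b + 3` WITH `k` fibres, `JJ (b + 3) k → closure (GG (b + 2) 1 k)`; part `KPiece`: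
the contact-aware engine run on one fan piece, in ENGINE base dimension `b + 1` (coordinates
`x' ∈ ℝᵇ`, `y`), every `b`, every `k`.)

Both theorems of this file are CONDITIONAL on the termwise-convergence lemma of the Taylor split
in engine base dimension `b + 1` with fibres under the WALL INVARIANT `hH` — the hypothesis `hHb`,
universally closed: the registered statement of `stub_separateTwoPos_hI`
(`…StubSeparateTwoPosHI`, the case `b = 1`, proved) with `(hb : b' = 1)` replaced by
`(hb : b' = b)`. For `b = 2` this is VERBATIM the lemma `hHk` of the base-dimension-3 part of the
stub (`hHk.md`; its rim-condition variant is false with fibres — the fibre mass may pinch at a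
two-dimensional letter contact, member `E₂` of W18 — while the wall-invariant form is exactly what
the engine delivers at its terminal pieces).

* `SepThreeK.terminal_of_hH`: a TERMINAL representation of the contact-aware engine
  `SepThree.sepC_induction` (cell `gDom b k`, separation shape with all active poles equal to `ℓ`,
  and the CONTACT INVARIANT: every `x'`-letter with non-zero exponent vanishes on the closed cell
  only at points of every active pole plane, some pole being active) is congruent modulo
  `KZ.relations` to a `ℤ`-combination of elements of `GG b 1 k`: the contact invariant is
  literally the wall invariant `hH` of the single surviving pole `ℓ` (`n = ∑ dⱼ ≠ 0` and
  `y = ℓ(x')` wherever an active `x'`-letter vanishes on the closed cell), so the Taylor split at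
  `ℓ` (`separatePos_taylor`, `separatePos_split`) converges termwise by `hHb`.
* `SepThreeK.piece` (registered as `separateThreeK_piece`): a literal arrangement representation
  over `gDom b k` in ENGINE COORDINATES — every active non-constant letter is a `y`-letter
  (`hact`), active `y`-letters do not vanish on the open cell (`hpole`), and the RATIO condition
  holds for every ordered pair of non-proportional active `y`-letters (`hrat`); this is the
  certificate of a fan piece of `separateHigh_fan_active` after the base change along its
  direction — is congruent modulo `KZ.relations` to a `ℤ`-combination of elements of `GG b 1 k`:
  `SepThree.sepC_induction` with the splitting rule, splittable pairs by the ratio conditions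
  ALONE (`SepThreeK.hunb_of_ratio`, part `KUnblocked`: NO thinness, special points, grid or
  fat-letter cancellation, in contrast with the fibre-free parts `Unblocked`/`Grid`/`Fat*`/`Cancel`
  of `stub_separateThreeZero`, whose cancellation `Lᵉ ∣ P` at a fat contact FAILS with fibres),
  and `terminal_of_hH` at the leaves. No cut is ever made: the cell of every node of the
  separation tree is the input cell, so no facet contact is created.
-/

noncomputable section

open Set MeasureTheory Filter Topology

namespace Summit.KontsevichZagierPeriods.ArrangementNormalForm.JanusBands

open Literature.NumberTheory.Transcendental

namespace SepThreeK

open SeparatePos SepThree MvPolynomial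

/-- **Terminal theorem of the engine with fibres, engine base dimension `b + 1`.** A terminal
representation of the contact-aware separation (cell `gDom b k`, shape with all active poles equal
to `ℓ`, contact invariant for every `x'`-letter) is congruent modulo `KZ.relations` to a
`ℤ`-combination of elements of `GG b 1 k`, GIVEN the termwise-convergence lemma `hHb` under the
wall invariant: Taylor split at `ℓ` (`separatePos_split`). -/
theorem terminal_of_hH {b k : ℕ}
    (hHb : ∀ (b' k' m m' n : ℕ) (s : KZ.IntegralRep (b' + 1 + k')) (M : Fin m' → (Fin (b' + 1) → ℚ) × ℚ) (L : Fin m → (Fin b' → ℚ) × ℚ) (e : Fin m → ℕ) (p : MvPolynomial (Fin (b' + 1)) ℚ) (ℓ : (Fin b' → ℚ) × ℚ) (a : Fin k' → Option ((Fin (b' + 1) → ℚ) × ℚ)) (lo hi : Fin k' → Fin k' ⊕ ((Fin (b' + 1) → ℚ) × ℚ)) (hpole : n ≠ 0 → ∀ z ∈ s.domain, (z (Fin.castAdd k' (Fin.last b')) - (∑ i, (ℓ.1 i : ℝ) * z (Fin.castAdd k' (Fin.castSucc i)) + (ℓ.2 : ℝ))) ≠ 0) (hbd : Bornology.IsBounded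 s.domain) (hdom : s.domain = {z | (∀ j, 0 < ∑ i, ((M j).1 i : ℝ) * z (Fin.castAdd k' i) + ((M j).2 : ℝ)) ∧ ∀ i, Sum.elim (fun j => z (Fin.natAdd (b' + 1) j)) (fun c => ∑ i', (c.1 i' : ℝ) * z (Fin.castAdd k' i') + (c.2 : ℝ)) (lo i) < z (Fin.natAdd (b' + 1) i) ∧ z (Fin.natAdd (b' + 1) i) < Sum.elim (fun j => z (Fin.natAdd (b' + 1) j)) (fun c => ∑ i', (c.1 i' : ℝ) * z (Fin.castAdd k' i') + (c.2 : ℝ)) (hi i)}) (hint : EqOn s.integrand (fun z => MvPolynomial.aeval (fun i => z (Fin.castAdd k' i)) p / (∏ j, (∑ i, ((L j).1 i : ℝ) * z (Fin.castAdd k' (Fin.castSucc i)) + ((L j).2 : ℝ)) ^ e j) * (1 / (z (Fin.castAdd k' (Fin.last b')) - (∑ i, (ℓ.1 i : ℝ) * z (Fin.castAdd k' (Fin.castSucc i)) + (ℓ.2 : ℝ))) ^ n) * ∏ i, (a i).elim 1 (fun c => 1 / (z (Fin.natAdd (b' + 1) i) - (∑ i', (c.1 i' : ℝ) * z (Fin.castAdd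 k' i') + (c.2 : ℝ))))) s.domain) (N : ℕ) (q : ℕ → MvPolynomial (Fin b') ℚ) (hq : ∀ z : Fin (b' + 1 + k') → ℝ, MvPolynomial.aeval (fun i => z (Fin.castAdd k' i)) p = ∑ i ∈ Finset.range N, MvPolynomial.aeval (fun i => z (Fin.castAdd k' (Fin.castSucc i))) (q i) * (z (Fin.castAdd k' (Fin.last b')) - (∑ i, (ℓ.1 i : ℝ) * z (Fin.castAdd k' (Fin.castSucc i)) + (ℓ.2 : ℝ))) ^ i) (hb : b' = b) (hH : ∀ j, e j ≠ 0 → ∀ z ∈ closure s.domain, (∑ i, ((L j).1 i : ℝ) * z (Fin.castAdd k' (Fin.castSucc i)) + ((L j).2 : ℝ)) = 0 → (n ≠ 0 ∧ z (Fin.castAdd k' (Fin.last b')) = ∑ i, (ℓ.1 i : ℝ) * z (Fin.castAdd k' (Fin.castSucc i)) + (ℓ.2 : ℝ))), ∀ i ∈ Finset.range N, IntegrableOn (fun z => MvPolynomial.aeval (fun i => z (Fin.castAdd k' (Fin.castSucc i))) (q i) / (∏ j, (∑ i, ((L j).1 i : ℝ) * z (Fin.castAdd k' (Fin.castSucc i))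 + ((L j).2 : ℝ)) ^ e j) * ((z (Fin.castAdd k' (Fin.last b')) - (∑ i, (ℓ.1 i : ℝ) * z (Fin.castAdd k' (Fin.castSucc i)) + (ℓ.2 : ℝ))) ^ i / (z (Fin.castAdd k' (Fin.last b')) - (∑ i, (ℓ.1 i : ℝ) * z (Fin.castAdd k' (Fin.castSucc i)) + (ℓ.2 : ℝ))) ^ n) * ∏ i, (a i).elim 1 (fun c => 1 / (z (Fin.natAdd (b' + 1) i) - (∑ i', (c.1 i' : ℝ) * z (Fin.castAdd k' i') + (c.2 : ℝ))))) s.domain)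
    {m' r : ℕ} (M : Fin m' → (Fin (b + 1) → ℚ) × ℚ)
    (p : MvPolynomial (Fin (b + 1)) ℚ) (lam : Fin r → (Fin b → ℚ) × ℚ)
    (a : Fin k → Option ((Fin (b + 1) → ℚ) × ℚ))
    (lo up : Fin k → Fin k ⊕ ((Fin (b + 1) → ℚ) × ℚ))
    {m : ℕ} (L : Fin m → (Fin b → ℚ) × ℚ) (e : Fin m → ℕ) (d : Fin r → ℕ)
    (s : KZ.IntegralRep (b + 1 + k)) (ℓ : (Fin b → ℚ) × ℚ)
    (hbd : Bornology.IsBounded s.domain) (hdom : s.domain = gDom b k m' M lo up)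
    (hint : EqOn s.integrand (shape b k p L e lam d a) s.domain)
    (hpole : ∀ j, d j ≠ 0 → ∀ z ∈ s.domain,
      z (Fin.castAdd k (Fin.last b)) - affB b k (lam j) z ≠ 0)
    (hℓ : ∀ j, d j ≠ 0 → lam j = ℓ)
    (hInv : ∀ l, e l ≠ 0 → ∀ z ∈ closure s.domain, affB b k (L l) z = 0 →
      (∃ i, d i ≠ 0) ∧ ∀ i, d i ≠ 0 → z (Fin.castAdd k (Fin.last b)) = affB b k (lam i) z) :
    ∃ c ∈ AddSubgroup.closure (GGset b 1 k), KZ.of s - c ∈ KZ.relations := by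
  set n := ∑ j, d j with hn
  -- single-pole form of the integrand
  have hint' : EqOn s.integrand (fun z => MvPolynomial.aeval (fun i => z (Fin.castAdd k i)) p /
      (∏ j, (∑ i, ((L j).1 i : ℝ) * z (Fin.castAdd k (Fin.castSucc i)) + ((L j).2 : ℝ)) ^ e j) *
      (1 / (z (Fin.castAdd k (Fin.last b)) - (∑ i, (ℓ.1 i : ℝ) * z (Fin.castAdd k
        (Fin.castSucc i)) + (ℓ.2 : ℝ))) ^ n) *
      ∏ i, (a i).elim 1 (fun c => 1 / (z (Fin.natAdd (b + 1) i) -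
        (∑ i', (c.1 i' : ℝ) * z (Fin.castAdd k i') + (c.2 : ℝ))))) s.domain := by
    intro z hz
    rw [hint hz]
    simp only [shape, fib, affB, one_div]
    congr 2
    rw [← Finset.prod_pow_eq_pow_sum, ← Finset.prod_inv_distrib]
    refine Finset.prod_congr rfl fun j _ => ?_
    by_cases hj : d j = 0
    · simp [hj]
    · rw [hℓ j hj]
  have hact : n ≠ 0 → ∃ j, d j ≠ 0 := fun h => by
    by_contra hall; push Not at hall
    exact h (Finset.sum_eq_zero fun j _ => hall j)
  have hpole' : n ≠ 0 → ∀ z ∈ s.domain, z (Fin.castAdd k (Fin.last b)) -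
      (∑ i, (ℓ.1 i : ℝ) * z (Fin.castAdd k (Fin.castSucc i)) + (ℓ.2 : ℝ)) ≠ 0 := fun h z hz => by
    obtain ⟨j, hj⟩ := hact h
    have := hpole j hj z hz
    rwa [hℓ j hj] at this
  -- the wall invariant of the surviving pole from the contact invariant
  have hH : ∀ j, e j ≠ 0 → ∀ z ∈ closure s.domain, (∑ i, ((L j).1 i : ℝ) *
      z (Fin.castAdd k (Fin.castSucc i)) + ((L j).2 : ℝ)) = 0 →
      (n ≠ 0 ∧ z (Fin.castAdd k (Fin.last b)) = ∑ i, (ℓ.1 i : ℝ) * z (Fin.castAdd k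
        (Fin.castSucc i)) + (ℓ.2 : ℝ)) := by
    intro j hej z hz h0
    obtain ⟨⟨i, hi⟩, hall⟩ := hInv j hej z hz h0
    refine ⟨fun h => hi ((Finset.sum_eq_zero_iff.1 h) i (Finset.mem_univ _)), ?_⟩
    have h1 := hall i hi
    rw [hℓ i hi] at h1
    exact h1
  obtain ⟨N, q, hq⟩ := separatePos_taylor b k p ℓ
  exact separatePos_split GGset (fun _ _ _ => rfl) b k m m' n s M L e p ℓ a lo up hpole' hbd hdom
    hint' N q hq (hHb b k m m' n s M L e p ℓ a lo up hpole' hbd hdom hint' N q hq rfl hH)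

/-- **Piece theorem of the engine with fibres, engine base dimension `b + 1`**: see the module
docstring. -/
theorem piece {b k : ℕ}
    (hHb : ∀ (b' k' m m' n : ℕ) (s : KZ.IntegralRep (b' + 1 + k')) (M : Fin m' → (Fin (b' + 1) → ℚ) × ℚ) (L : Fin m → (Fin b' → ℚ) × ℚ) (e : Fin m → ℕ) (p : MvPolynomial (Fin (b' + 1)) ℚ) (ℓ : (Fin b' → ℚ) × ℚ) (a : Fin k' → Option ((Fin (b' + 1) → ℚ) × ℚ)) (lo hi : Fin k' → Fin k' ⊕ ((Fin (b' + 1) → ℚ) × ℚ)) (hpole : n ≠ 0 → ∀ z ∈ s.domain, (z (Fin.castAdd k' (Fin.last b')) - (∑ i, (ℓ.1 i : ℝ) * z (Fin.castAdd k' (Fin.castSucc i)) + (ℓ.2 : ℝ))) ≠ 0) (hbd : Bornology.IsBounded s.domain) (hdom : s.domain = {z | (∀ j, 0 < ∑ i, ((M j).1 i : ℝ) * z (Fin.castAdd k' i) + ((M j).2 : ℝ)) ∧ ∀ i, Sum.elim (fun j => z (Fin.natAdd (b' + 1) j)) (fun c => ∑ i', (c.1 i' : ℝ) * z (Fin.castAdd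 k' i') + (c.2 : ℝ)) (lo i) < z (Fin.natAdd (b' + 1) i) ∧ z (Fin.natAdd (b' + 1) i) < Sum.elim (fun j => z (Fin.natAdd (b' + 1) j)) (fun c => ∑ i', (c.1 i' : ℝ) * z (Fin.castAdd k' i') + (c.2 : ℝ)) (hi i)}) (hint : EqOn s.integrand (fun z => MvPolynomial.aeval (fun i => z (Fin.castAdd k' i)) p / (∏ j, (∑ i, ((L j).1 i : ℝ) * z (Fin.castAdd k' (Fin.castSucc i)) + ((L j).2 : ℝ)) ^ e j) * (1 / (z (Fin.castAdd k' (Fin.last b')) - (∑ i, (ℓ.1 i : ℝ) * z (Fin.castAdd k' (Fin.castSucc i)) + (ℓ.2 : ℝ))) ^ n) * ∏ i, (a i).elim 1 (fun c => 1 / (z (Fin.natAdd (b' + 1) i) - (∑ i', (c.1 i' : ℝ) * z (Fin.castAdd k' i') + (c.2 : ℝ))))) s.domain) (N : ℕ) (q : ℕ → MvPolynomial (Fin b') ℚ) (hq : ∀ z : Fin (b' + 1 + k') → ℝ, MvPolynomial.aeval (fun i => z (Fin.castAdd k' i)) p = ∑ i ∈ Finset.range N, MvPolynomial.aeval (fun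 i => z (Fin.castAdd k' (Fin.castSucc i))) (q i) * (z (Fin.castAdd k' (Fin.last b')) - (∑ i, (ℓ.1 i : ℝ) * z (Fin.castAdd k' (Fin.castSucc i)) + (ℓ.2 : ℝ))) ^ i) (hb : b' = b) (hH : ∀ j, e j ≠ 0 → ∀ z ∈ closure s.domain, (∑ i, ((L j).1 i : ℝ) * z (Fin.castAdd k' (Fin.castSucc i)) + ((L j).2 : ℝ)) = 0 → (n ≠ 0 ∧ z (Fin.castAdd k' (Fin.last b')) = ∑ i, (ℓ.1 i : ℝ) * z (Fin.castAdd k' (Fin.castSucc i)) + (ℓ.2 : ℝ))), ∀ i ∈ Finset.range N, IntegrableOn (fun z => MvPolynomial.aeval (fun i => z (Fin.castAdd k' (Fin.castSucc i))) (q i) / (∏ j, (∑ i, ((L j).1 i : ℝ) * z (Fin.castAdd k' (Fin.castSucc i)) + ((L j).2 : ℝ)) ^ e j) * ((z (Fin.castAdd k' (Fin.last b')) - (∑ i, (ℓ.1 i : ℝ) * z (Fin.castAdd k' (Fin.castSucc i)) + (ℓ.2 : ℝ))) ^ i / (z (Fin.castAdd k' (Fin.last b')) - (∑ i, (ℓ.1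 i : ℝ) * z (Fin.castAdd k' (Fin.castSucc i)) + (ℓ.2 : ℝ))) ^ n) * ∏ i, (a i).elim 1 (fun c => 1 / (z (Fin.natAdd (b' + 1) i) - (∑ i', (c.1 i' : ℝ) * z (Fin.castAdd k' i') + (c.2 : ℝ))))) s.domain)
    {m m' : ℕ} (s : KZ.IntegralRep (b + 1 + k))
    (M : Fin m' → (Fin (b + 1) → ℚ) × ℚ) (L : Fin m → (Fin (b + 1) → ℚ) × ℚ) (e : Fin m → ℕ)
    (p : MvPolynomial (Fin (b + 1)) ℚ) (a : Fin k → Option ((Fin (b + 1) → ℚ) × ℚ))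
    (lo hi : Fin k → Fin k ⊕ ((Fin (b + 1) → ℚ) × ℚ))
    (hbd : Bornology.IsBounded s.domain) (hdom : s.domain = gDom b k m' M lo hi)
    (hint : EqOn s.integrand (fun z => MvPolynomial.aeval (fun i => z (Fin.castAdd k i)) p /
      (∏ j, affF b k (L j) z ^ e j) * fib b k a z) s.domain)
    (hact : ∀ j, e j ≠ 0 → (L j).1 ≠ 0 → (L j).1 (Fin.last b) ≠ 0)
    (hpole : ∀ j, (L j).1 (Fin.last b) ≠ 0 → e j ≠ 0 → ∀ z ∈ s.domain, affF b k (L j) z ≠ 0)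
    (hrat : ∀ j j', (L j).1 (Fin.last b) ≠ 0 → (L j').1 (Fin.last b) ≠ 0 → e j ≠ 0 → e j' ≠ 0 →
      (L j').1 (Fin.last b) • L j ≠ (L j).1 (Fin.last b) • L j' → ∃ C : ℝ, ∀ z ∈ s.domain,
      |affF b k (L j') z| ≤ C * |((L j).1 (Fin.last b) : ℝ) * affF b k (L j') z -
        ((L j').1 (Fin.last b) : ℝ) * affF b k (L j) z|) :
    ∃ c ∈ AddSubgroup.closure (GGset b 1 k), KZ.of s - c ∈ KZ.relations := by
  classical
  -- a vanishing active letter makes the integrand zero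
  by_cases hL : ∃ j, e j ≠ 0 ∧ L j = 0
  · obtain ⟨j, hej, hLj⟩ := hL
    refine ⟨0, zero_mem _, ?_⟩
    rw [sub_zero]
    refine KZ.of_mem_relations_of_eqOn_zero s fun z hz => ?_
    rw [hint hz]
    have h0 : affF b k (L j) z ^ e j = 0 := by
      rw [hLj]; simp [affF, zero_pow hej]
    simp only [Pi.zero_apply]
    rw [Finset.prod_eq_zero (Finset.mem_univ j) h0, div_zero, zero_mul]
  push Not at hL
  -- the separation shape of the input
  set lam : Fin m → (Fin b → ℚ) × ℚ := fun j => root b (L j) with hlam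
  set d : Fin m → ℕ := fun j => if (L j).1 (Fin.last b) = 0 then 0 else e j with hdd
  set Lb : Fin m → (Fin b → ℚ) × ℚ := fun j => if (L j).1 (Fin.last b) = 0 then restr b (L j)
    else (0, 1) with hLb
  set eb : Fin m → ℕ := fun j => if (L j).1 (Fin.last b) = 0 then e j else 0 with heb
  set p' : MvPolynomial (Fin (b + 1)) ℚ := MvPolynomial.C (∏ j, lead b (L j) (e j))⁻¹ * p with hp'
  have hd : ∀ j, d j ≠ 0 → (L j).1 (Fin.last b) ≠ 0 ∧ e j ≠ 0 := fun j hj => by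
    have hdj : d j = if (L j).1 (Fin.last b) = 0 then 0 else e j := rfl
    by_cases h : (L j).1 (Fin.last b) = 0
    · rw [hdj, if_pos h] at hj; exact absurd rfl hj
    · rw [hdj, if_neg h] at hj; exact ⟨h, hj⟩
  have hshape : EqOn s.integrand (shape b k p' Lb eb lam d a) s.domain := fun z hz => by
    rw [hint hz]; exact jshape_eq L e _ a z
  set act : Fin m → Prop := fun j => (L j).1 (Fin.last b) ≠ 0 ∧ e j ≠ 0 with hactdef
  have hd' : ∀ j, act j → d j ≠ 0 := fun j hj => by
    have hdj : d j = if (L j).1 (Fin.last b) = 0 then 0 else e j := rfl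
    rw [hdj, if_neg hj.1]
    exact hj.2
  -- the hypotheses of the engine
  have hpole' : ∀ j, d j ≠ 0 → ∀ z ∈ s.domain,
      z (Fin.castAdd k (Fin.last b)) - affB b k (lam j) z ≠ 0 := fun j hj z hz => by
    obtain ⟨hα, he⟩ := hd j hj
    have h := hpole j hα he z hz
    rw [affF_of_ne_zero (L j) z hα] at h
    exact right_ne_zero_of_mul h
  have hrat' : ∀ j j', act j → act j' → lam j ≠ lam j' →
      ∃ C, ∀ z ∈ gDom b k m' M lo hi, |z (Fin.castAdd k (Fin.last b)) - affB b k (lam j') z| ≤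
        C * |affB b k (lam j) z - affB b k (lam j') z| := by
    rintro j j' ⟨hα, he⟩ ⟨hα', he'⟩ hne
    obtain ⟨C, hC⟩ := hrat j j' hα hα' he he' fun h => hne (root_eq_of_smul_eq hα hα' h)
    rw [← hdom]
    exact ⟨C * |((L j).1 (Fin.last b) : ℝ)|, fun z hz => ratio_of_literal (L j) (L j') hα hα' z
      (hC z hz)⟩
  -- every family of active poles is unblocked (part `KUnblocked`)
  have hunb := hunb_of_ratio M lo hi lam act
    (fun j hj z hz => hpole' j (hd' j hj) z (by rw [hdom]; exact hz)) hrat'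
  have hinv0 : ∀ l, eb l ≠ 0 → ∀ z ∈ closure s.domain, affB b k (Lb l) z = 0 →
      (∃ i, d i ≠ 0) ∧ ∀ i, d i ≠ 0 → z (Fin.castAdd k (Fin.last b)) = affB b k (lam i) z := by
    intro l hl z _ h0
    exfalso
    have hel : eb l = if (L l).1 (Fin.last b) = 0 then e l else 0 := rfl
    by_cases hy : (L l).1 (Fin.last b) = 0
    · rw [hel, if_pos hy] at hl
      have hlin : (L l).1 = 0 := by
        by_contra h; exact hact l hl h hy
      have hc2 : (L l).2 ≠ 0 := fun h => hL l hl (Prod.ext hlin h)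
      have hL' : Lb l = restr b (L l) := by
        show (if (L l).1 (Fin.last b) = 0 then restr b (L l) else (0, 1)) = _; rw [if_pos hy]
      rw [hL'] at h0
      simp only [affB, restr, hlin, Pi.zero_apply, Rat.cast_zero, zero_mul,
        Finset.sum_const_zero, zero_add, Rat.cast_eq_zero] at h0
      exact hc2 h0
    · rw [hel, if_neg hy] at hl; exact hl rfl
  -- separation + terminal theorem
  set T : Set KZ.FormalRep := {w | ∃ c ∈ AddSubgroup.closure (GGset b 1 k),
    w - c ∈ KZ.relations} with hTdef
  have hT := fun (n : ℕ) (L' : Fin n → (Fin b → ℚ) × ℚ) (e' : Fin n → ℕ) (d' : Fin m → ℕ)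
    (s' : KZ.IntegralRep (b + 1 + k)) (ℓ : (Fin b → ℚ) × ℚ) hbd'' hdom' hint' hpole'' hℓ hinv =>
    show KZ.of s' ∈ T from
      terminal_of_hH hHb M p' lam a lo hi L' e' d' s' ℓ hbd'' hdom' hint' hpole'' hℓ hinv
  obtain ⟨c, hc, hsc⟩ := sepC_induction b k m' m M p' lam a lo hi act T hT hrat' hunb (∑ j, d j)
    m Lb eb d s rfl hbd hdom hshape hpole' hd hinv0
  obtain ⟨c', hc', hcc⟩ := SepTwoZero.closure_transfer' (S := T) (T := GGset b 1 k)
    (fun x hx => hx) c hc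
  refine ⟨c', hc', ?_⟩
  have := add_mem hsc hcc
  rwa [sub_add_sub_cancel] at this

end SepThreeK

open SepThreeK SeparatePos in
/-- **Piece theorem of the separation engine with fibres, every base dimension** (registered
sub-goal of `stub_separateHigh`, part `KPiece`; see `SepThreeK.piece` and the module
docstring): conditional on the termwise-convergence lemma `hHb` under the wall invariant in engine
base dimension `b + 1`. -/
theorem separateThreeK_piece (b k : ℕ) (hHb : ∀ (b' k' m m' n : ℕ) (s : KZ.IntegralRep (b' + 1 + k')) (M : Fin m' → (Fin (b' + 1) → ℚ) × ℚ) (L : Fin m → (Fin b' → ℚ) × ℚ) (e : Fin m → ℕ) (p : MvPolynomial (Fin (b' + 1)) ℚ) (ℓ : (Fin b' → ℚ) × ℚ) (a : Fin k' → Option ((Fin (b' + 1) → ℚ) × ℚ)) (lo hi : Fin k' → Fin k' ⊕ ((Fin (b' + 1) → ℚ) × ℚ)) (hpole : n ≠ 0 → ∀ z ∈ s.domain, (z (Fin.castAdd k' (Fin.last b')) - (∑ i, (ℓ.1 i : ℝ) * z (Fin.castAdd k' (Fin.castSucc i)) + (ℓ.2 : ℝ))) ≠ 0) (hbd : Bornology.IsBounded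 s.domain) (hdom : s.domain = {z | (∀ j, 0 < ∑ i, ((M j).1 i : ℝ) * z (Fin.castAdd k' i) + ((M j).2 : ℝ)) ∧ ∀ i, Sum.elim (fun j => z (Fin.natAdd (b' + 1) j)) (fun c => ∑ i', (c.1 i' : ℝ) * z (Fin.castAdd k' i') + (c.2 : ℝ)) (lo i) < z (Fin.natAdd (b' + 1) i) ∧ z (Fin.natAdd (b' + 1) i) < Sum.elim (fun j => z (Fin.natAdd (b' + 1) j)) (fun c => ∑ i', (c.1 i' : ℝ) * z (Fin.castAdd k' i') + (c.2 : ℝ)) (hi i)}) (hint : EqOn s.integrand (fun z => MvPolynomial.aeval (fun i => z (Fin.castAdd k' i)) p / (∏ j, (∑ i, ((L j).1 i : ℝ) * z (Fin.castAdd k' (Fin.castSucc i)) + ((L j).2 : ℝ)) ^ e j) * (1 / (z (Fin.castAdd k' (Fin.last b')) - (∑ i, (ℓ.1 i : ℝ) * z (Fin.castAdd k' (Fin.castSucc i)) + (ℓ.2 : ℝ))) ^ n) * ∏ i, (a i).elim 1 (fun c => 1 / (z (Fin.natAdd (b' + 1) i) - (∑ i', (c.1 i' : ℝ) * z (Fin.castAdd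 k' i') + (c.2 : ℝ))))) s.domain) (N : ℕ) (q : ℕ → MvPolynomial (Fin b') ℚ) (hq : ∀ z : Fin (b' + 1 + k') → ℝ, MvPolynomial.aeval (fun i => z (Fin.castAdd k' i)) p = ∑ i ∈ Finset.range N, MvPolynomial.aeval (fun i => z (Fin.castAdd k' (Fin.castSucc i))) (q i) * (z (Fin.castAdd k' (Fin.last b')) - (∑ i, (ℓ.1 i : ℝ) * z (Fin.castAdd k' (Fin.castSucc i)) + (ℓ.2 : ℝ))) ^ i) (hb : b' = b) (hH : ∀ j, e j ≠ 0 → ∀ z ∈ closure s.domain, (∑ i, ((L j).1 i : ℝ) * z (Fin.castAdd k' (Fin.castSucc i)) + ((L j).2 : ℝ)) = 0 → (n ≠ 0 ∧ z (Fin.castAdd k' (Fin.last b')) = ∑ i, (ℓ.1 i : ℝ) * z (Fin.castAdd k' (Fin.castSucc i)) + (ℓ.2 : ℝ))), ∀ i ∈ Finset.range N, IntegrableOn (fun z => MvPolynomial.aeval (fun i => z (Fin.castAdd k' (Fin.castSucc i))) (q i) / (∏ j, (∑ i, ((L j).1 i : ℝ) * z (Fin.castAdd k' (Fin.castSucc i))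 + ((L j).2 : ℝ)) ^ e j) * ((z (Fin.castAdd k' (Fin.last b')) - (∑ i, (ℓ.1 i : ℝ) * z (Fin.castAdd k' (Fin.castSucc i)) + (ℓ.2 : ℝ))) ^ i / (z (Fin.castAdd k' (Fin.last b')) - (∑ i, (ℓ.1 i : ℝ) * z (Fin.castAdd k' (Fin.castSucc i)) + (ℓ.2 : ℝ))) ^ n) * ∏ i, (a i).elim 1 (fun c => 1 / (z (Fin.natAdd (b' + 1) i) - (∑ i', (c.1 i' : ℝ) * z (Fin.castAdd k' i') + (c.2 : ℝ))))) s.domain) (m m' : ℕ) (s : KZ.IntegralRep (b + 1 + k)) (M : Fin m' → (Fin (b + 1) → ℚ) × ℚ) (L : Fin m → (Fin (b + 1) → ℚ) × ℚ) (e : Fin m → ℕ) (p : MvPolynomial (Fin (b + 1)) ℚ) (a : Fin k → Option ((Fin (b + 1) → ℚ) × ℚ)) (lo hi : Fin k → Fin k ⊕ ((Fin (b + 1) → ℚ) × ℚ)) (hbd : Bornology.IsBounded s.domain) (hdom : s.domain = SeparatePos.gDom b k m' M lo hi) (hint : EqOn s.integrand (fun z => MvPolynomial.aeval (fun i => z (Fin.castAdd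 k i)) p / (∏ j, SeparatePos.affF b k (L j) z ^ e j) * SeparatePos.fib b k a z) s.domain) (hact : ∀ j, e j ≠ 0 → (L j).1 ≠ 0 → (L j).1 (Fin.last b) ≠ 0) (hpole : ∀ j, (L j).1 (Fin.last b) ≠ 0 → e j ≠ 0 → ∀ z ∈ s.domain, SeparatePos.affF b k (L j) z ≠ 0) (hrat : ∀ j j', (L j).1 (Fin.last b) ≠ 0 → (L j').1 (Fin.last b) ≠ 0 → e j ≠ 0 → e j' ≠ 0 → (L j').1 (Fin.last b) • L j ≠ (L j).1 (Fin.last b) • L j' → ∃ C : ℝ, ∀ z ∈ s.domain, |SeparatePos.affF b k (L j') z| ≤ C * |((L j).1 (Fin.last b) : ℝ) * SeparatePos.affF b k (L j') z - ((L j').1 (Fin.last b) : ℝ) * SeparatePos.affF b k (L j) z|) : ∃ c ∈ AddSubgroup.closure (SeparatePos.GGset b 1 k), KZ.of s - c ∈ KZ.relations :=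
  piece hHb s M L e p a lo hi hbd hdom hint hact hpole hrat

end Summit.KontsevichZagierPeriods.ArrangementNormalForm.JanusBands
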